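import Literature.Topology.PlanarFoliations.LoopLeaf
import Mathlib.Topology.Covering.AddCircle
import Mathlib.Topology.Homotopy.Path
import HarnessLib

/-!
# Loops of degree one in a circle

Topic: Topology / PlanarFoliations (generic circle topology, used for the compact leaves of
planar foliations). Let `Y` be a Hausdorff space parametrised by an injective loop
`β : ℝ → Y` — continuous, `1`-periodic, injective on `[0, 1)` and onto (`LeafLoop.lean`
produces such parametrisations of compact leaves) — so that `Y` is a circle and
`β = Θ ∘ (ℝ → ℝ/ℤ)` for a homeomorphism `Θ : ℝ/ℤ ≃ₜ Y` (`exists_homeomorph_addCircle`). Every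
loop `h` of `Y` at `β 0` lifts through `β` to a path `h̃` of `ℝ` from `0` to an integer `d`, its
degree (`exists_lift_loop`), and `h` is homotopic with fixed ends to `θ ↦ β θ` when `d = 1`, to
`θ ↦ β (-θ)` when `d = -1` (`homotopic_loop_of_lift_eq_one`, `homotopic_revLoop_of_lift_eq_neg_one`:
interpolate the lifts linearly and push down).

The main result is a **criterion for degree `±1`** read in an *arc chart* `c` at the base
point (an open partial homeomorphism of `Y` onto the real line, e.g. a leaf arc of a planar
foliation): if for some `θ₁ ∈ (0, 1/2)` the loop `h` (a) lies in the source of `c` for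
`θ ≤ θ₁` and for `θ ≥ 1 - θ₁`, (b) avoids the base point for `θ ∈ [θ₁, 1 - θ₁]`, and (c) has
chart coordinate on one side of that of the base point at `θ₁` and on the other side at
`1 - θ₁`, then `d = ±1` (`lift_eq_one_or_neg_one`, with the lemmas `exists_not_mem_source`,
`abs_lt_one_of_mem_component`, `mul_pos_of_same_side`), hence **`h` is homotopic to one of
the two injective loops `β`, `β(-·)`** (`homotopic_loop_or_revLoop`). These are exactly the
properties of the horizontals of a closed fence near a compact leaf established in
`StabilityBand.lean` (`ClosedFence.exists_constants`), so the horizontals of the band of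
closed leaves are, up to homotopy in their leaves, the simple loops of those leaves.

Proof of the criterion: the component `J₀ ∋ 0` of `β⁻¹(c.source)` is an open interval of
length `≤ 1` (else `β(J₀) = Y` would lie in the source of `c`, a copy of the noncompact
line), on which `c ∘ β` is continuous and injective, hence monotone; the lift runs in `J₀`
on `[0, θ₁]` and in `d + J₀` on `[1 - θ₁, 1]`, avoids the integers on `[θ₁, 1 - θ₁]` (so
its integer part is the same at `θ₁` and `1 - θ₁`), and the side conditions place `h̃ θ₁`
and `h̃ (1 - θ₁) - d` on opposite sides of `0`; counting integer parts gives `d = ±1`.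

All statements are [folklore] (covering space theory of the circle, e.g. Hatcher,
*Algebraic Topology*, Thm. 1.7 and its proof).
-/

noncomputable section

open Set Filter Function
open _root_.Topology unitInterval

namespace Literature.Topology.PlanarFoliations

namespace CircleLoops

variable {Y : Type*} {β : ℝ → Y}

/-! ## The circle parametrisation -/

/-- A `1`-periodic map takes the same value at `r` and at its fractional part. [folklore] -/
theorem apply_fract (hp : Periodic β 1) (r : ℝ) : β (Int.fract r) = β r := by
  rw [show Int.fract r = r - (⌊r⌋ : ℤ) * (1 : ℝ) by rw [mul_one]; rfl]
  exact hp.sub_int_mul_eq ⌊r⌋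

/-- A `1`-periodic map takes the value `β 0` at every integer. [folklore] -/
theorem apply_intCast (hp : Periodic β 1) (n : ℤ) : β n = β 0 := by
  have h := hp.int_mul n 0
  rwa [zero_add, mul_one] at h

/-- For a `1`-periodic map injective on `[0, 1)`, `β r = β 0` iff `r` is an integer. [folklore] -/
theorem apply_eq_apply_zero_iff (hp : Periodic β 1) (hinj : InjOn β (Ico 0 1)) (r : ℝ) :
    β r = β 0 ↔ ∃ n : ℤ, (n : ℝ) = r := by
  constructor
  · intro h
    rw [← apply_fract hp r] at h
    have hfr : Int.fract r = 0 :=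
      hinj ⟨Int.fract_nonneg r, Int.fract_lt_one r⟩ ⟨le_rfl, zero_lt_one⟩ h
    refine ⟨⌊r⌋, ?_⟩
    have := Int.fract_add_floor r
    rw [hfr, zero_add] at this
    exact this
  · rintro ⟨n, rfl⟩
    exact apply_intCast hp n

variable [TopologicalSpace Y]

/-- **An injective loop onto a Hausdorff space is a circle**: there is a homeomorphism
`Θ : ℝ/ℤ ≃ₜ Y` with `Θ ↑s = β s` for all real `s`. [folklore] -/
theorem exists_homeomorph_addCircle [T2Space Y] (hc : Continuous β) (hp : Periodic β 1)
    (hinj : InjOn β (Ico 0 1)) (hsurj : range β = univ) :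
    ∃ Θ : AddCircle (1 : ℝ) ≃ₜ Y, ∀ s : ℝ, Θ (s : AddCircle (1 : ℝ)) = β s := by
  haveI : Fact ((0 : ℝ) < 1) := ⟨one_pos⟩
  set f : AddCircle (1 : ℝ) → Y := AddCircle.liftIco 1 0 β with hf
  have hfc : Continuous f := AddCircle.liftIco_zero_continuous (by simpa using (hp 0).symm) hc.continuousOn
  have hfapply : ∀ s : ℝ, s ∈ Ico (0 : ℝ) 1 → f (s : AddCircle (1 : ℝ)) = β s := fun s hs ↦
    AddCircle.liftIco_coe_apply (by simpa using hs)
  have hrep : ∀ a : AddCircle (1 : ℝ), ∃ s ∈ Ico (0 : ℝ) 1, (s : AddCircle (1 : ℝ)) = a := fun a ↦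
    ⟨(AddCircle.equivIco 1 0 a : ℝ), by simpa using (AddCircle.equivIco 1 0 a).2, AddCircle.coe_equivIco⟩
  have hfinj : Injective f := by
    intro a b hab
    obtain ⟨s, hs, rfl⟩ := hrep a
    obtain ⟨t, ht, rfl⟩ := hrep b
    rw [hfapply s hs, hfapply t ht] at hab
    rw [hinj hs ht hab]
  have hfsurj : Surjective f := by
    intro y
    obtain ⟨t, rfl⟩ : y ∈ range β := by rw [hsurj]; exact mem_univ y
    refine ⟨(Int.fract t : ℝ), ?_⟩
    rw [hfapply _ ⟨Int.fract_nonneg t, Int.fract_lt_one t⟩, apply_fract hp]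
  haveI : CompactSpace (AddCircle (1 : ℝ)) := inferInstance
  set Θ : AddCircle (1 : ℝ) ≃ₜ Y :=
    Continuous.homeoOfEquivCompactToT2 (f := Equiv.ofBijective f ⟨hfinj, hfsurj⟩) hfc with hΘ
  refine ⟨Θ, fun s ↦ ?_⟩
  show f (s : AddCircle (1 : ℝ)) = β s
  have hs : ((Int.fract s : ℝ) : AddCircle (1 : ℝ)) = (s : AddCircle (1 : ℝ)) := by
    have e1 : Int.fract s = s + ((-⌊s⌋ : ℤ) • (1 : ℝ)) := by
      rw [neg_zsmul, zsmul_one, ← sub_eq_add_neg]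
      rfl
    rw [e1, AddCircle.coe_add, AddCircle.coe_zsmul, AddCircle.coe_period, zsmul_zero, add_zero]
  rw [← hs, hfapply _ ⟨Int.fract_nonneg s, Int.fract_lt_one s⟩, apply_fract hp]

/-! ## Lifting loops through the parametrisation -/

/-- **Loops at the base point lift to paths of the line from `0` to an integer.** [folklore] -/
theorem exists_lift_loop [T2Space Y] (hc : Continuous β) (hp : Periodic β 1) (hinj : InjOn β (Ico 0 1))
    (hsurj : range β = univ) (h : Path (β 0) (β 0)) :
    ∃ Γ : C(I, ℝ), Γ 0 = 0 ∧ (∀ θ, β (Γ θ) = h θ) ∧ ∃ d : ℤ, Γ 1 = d := by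
  obtain ⟨Θ, hΘ⟩ := exists_homeomorph_addCircle hc hp hinj hsurj
  -- the loop in `ℝ/ℤ`
  set k : C(I, AddCircle (1 : ℝ)) := ⟨fun θ ↦ Θ.symm (h θ), Θ.symm.continuous.comp h.continuous⟩ with hk
  have hk0 : k 0 = ((0 : ℝ) : AddCircle (1 : ℝ)) := by
    show Θ.symm (h 0) = _
    rw [h.source, ← hΘ 0, Θ.symm_apply_apply]
  set Γ : C(I, ℝ) := (AddCircle.isCoveringMap_coe 1).liftPath k 0 hk0 with hΓ
  have hlift : ∀ θ, ((Γ θ : ℝ) : AddCircle (1 : ℝ)) = k θ := fun θ ↦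
    congr_fun ((AddCircle.isCoveringMap_coe 1).liftPath_lifts k 0 hk0) θ
  have hβΓ : ∀ θ, β (Γ θ) = h θ := fun θ ↦ by
    rw [← hΘ, hlift]
    exact Θ.apply_symm_apply (h θ)
  refine ⟨Γ, (AddCircle.isCoveringMap_coe 1).liftPath_zero k 0 hk0, hβΓ, ?_⟩
  have h1 : β (Γ 1) = β 0 := by rw [hβΓ, h.target]
  obtain ⟨d, hd⟩ := (apply_eq_apply_zero_iff hp hinj _).1 h1
  exact ⟨d, hd.symm⟩

/-- The injective loop as a path at its base point. [folklore] -/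
def loop (hc : Continuous β) (hp : Periodic β 1) : Path (β 0) (β 0) where
  toFun θ := β θ
  continuous_toFun := hc.comp continuous_subtype_val
  source' := rfl
  target' := by simpa using hp 0

/-- The values of `loop`. [folklore] -/
@[simp] theorem loop_apply (hc : Continuous β) (hp : Periodic β 1) (θ : I) : loop hc hp θ = β θ := rfl

/-- The reversed injective loop as a path at its base point. [folklore] -/
def revLoop (hc : Continuous β) (hp : Periodic β 1) : Path (β 0) (β 0) where
  toFun θ := β (-θ)
  continuous_toFun := hc.comp (continuous_subtype_val.neg)
  source' := by simp
  target' := by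
    show β (-(1 : ℝ)) = β 0
    have h := hp (-1)
    rw [neg_add_cancel] at h
    exact h.symm

/-- The values of `revLoop`. [folklore] -/
@[simp] theorem revLoop_apply (hc : Continuous β) (hp : Periodic β 1) (θ : I) : revLoop hc hp θ = β (-θ) := rfl

/-- **A loop whose lift ends at `1` is homotopic to the injective loop** (interpolate the lift
linearly with the identity and push down). [folklore] -/
theorem homotopic_loop_of_lift_eq_one (hc : Continuous β) (hp : Periodic β 1) (h : Path (β 0) (β 0))
    (Γ : C(I, ℝ)) (hΓ0 : Γ 0 = 0) (hΓ : ∀ θ, β (Γ θ) = h θ) (hΓ1 : Γ 1 = 1) :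
    h.Homotopic (loop hc hp) := by
  refine ⟨{ toFun := fun p ↦ β ((1 - (p.1 : ℝ)) * Γ p.2 + (p.1 : ℝ) * (p.2 : ℝ))
            continuous_toFun := ?_
            map_zero_left := fun θ ↦ ?_
            map_one_left := fun θ ↦ ?_
            prop' := fun r θ hθ ↦ ?_ }⟩
  · refine hc.comp ?_
    have hr : Continuous fun p : I × I ↦ ((p.1 : I) : ℝ) := continuous_subtype_val.comp continuous_fst
    have hθ : Continuous fun p : I × I ↦ ((p.2 : I) : ℝ) := continuous_subtype_val.comp continuous_snd
    exact ((continuous_const.sub hr).mul (Γ.continuous.comp continuous_snd)).add (hr.mul hθ)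
  · show β ((1 - (0 : ℝ)) * Γ θ + (0 : ℝ) * (θ : ℝ)) = h θ
    rw [sub_zero, one_mul, zero_mul, add_zero, hΓ]
  · show β ((1 - (1 : ℝ)) * Γ θ + (1 : ℝ) * (θ : ℝ)) = β θ
    rw [sub_self, zero_mul, one_mul, zero_add]
  · show β ((1 - (r : ℝ)) * Γ θ + (r : ℝ) * (θ : ℝ)) = h θ
    rcases hθ with rfl | rfl
    · rw [hΓ0, show ((0 : I) : ℝ) = 0 from rfl, mul_zero, mul_zero, add_zero, ← hΓ 0, hΓ0]
    · rw [hΓ1, show ((1 : I) : ℝ) = 1 from rfl, mul_one, mul_one, sub_add_cancel, ← hΓ 1, hΓ1]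

/-- **A loop whose lift ends at `-1` is homotopic to the reversed injective loop.** [folklore] -/
theorem homotopic_revLoop_of_lift_eq_neg_one (hc : Continuous β) (hp : Periodic β 1) (h : Path (β 0) (β 0))
    (Γ : C(I, ℝ)) (hΓ0 : Γ 0 = 0) (hΓ : ∀ θ, β (Γ θ) = h θ) (hΓ1 : Γ 1 = -1) :
    h.Homotopic (revLoop hc hp) := by
  refine ⟨{ toFun := fun p ↦ β ((1 - (p.1 : ℝ)) * Γ p.2 + (p.1 : ℝ) * (-(p.2 : ℝ)))
            continuous_toFun := ?_
            map_zero_left := fun θ ↦ ?_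
            map_one_left := fun θ ↦ ?_
            prop' := fun r θ hθ ↦ ?_ }⟩
  · refine hc.comp ?_
    have hr : Continuous fun p : I × I ↦ ((p.1 : I) : ℝ) := continuous_subtype_val.comp continuous_fst
    have hθ : Continuous fun p : I × I ↦ ((p.2 : I) : ℝ) := continuous_subtype_val.comp continuous_snd
    exact ((continuous_const.sub hr).mul (Γ.continuous.comp continuous_snd)).add (hr.mul hθ.neg)
  · show β ((1 - (0 : ℝ)) * Γ θ + (0 : ℝ) * (-(θ : ℝ))) = h θ
    rw [sub_zero, one_mul, zero_mul, add_zero, hΓ]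
  · show β ((1 - (1 : ℝ)) * Γ θ + (1 : ℝ) * (-(θ : ℝ))) = β (-θ)
    rw [sub_self, zero_mul, one_mul, zero_add]
  · show β ((1 - (r : ℝ)) * Γ θ + (r : ℝ) * (-(θ : ℝ))) = h θ
    rcases hθ with rfl | rfl
    · rw [hΓ0, show ((0 : I) : ℝ) = 0 from rfl, neg_zero, mul_zero, mul_zero, add_zero, ← hΓ 0, hΓ0]
    · rw [hΓ1, show ((1 : I) : ℝ) = 1 from rfl, mul_neg_one, mul_neg_one, ← neg_add, sub_add_cancel,
        ← hΓ 1, hΓ1]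

/-! ## The degree-one criterion -/

section Criterion

variable (hc : Continuous β) (hp : Periodic β 1) (hinj : InjOn β (Ico 0 1))
  (hsurj : range β = univ) {c : OpenPartialHomeomorph Y ℝ} (hct : c.target = univ)

include hc hp hsurj hct in
/-- **The source of an arc chart is not the whole circle** (the circle is compact, the line
is not). [folklore] -/
theorem exists_not_mem_source : ∃ r, β r ∉ c.source := by
  by_contra hall
  simp only [not_exists, not_not] at hall
  have hsrc : c.source = univ := by
    refine eq_univ_of_forall fun y ↦ ?_
    obtain ⟨r, rfl⟩ : y ∈ range β := by rw [hsurj]; exact mem_univ y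
    exact hall r
  have hcpt : IsCompact (univ : Set Y) := by
    have h : univ ⊆ β '' Icc 0 1 := fun y _ ↦ by
      obtain ⟨r, rfl⟩ : y ∈ range β := by rw [hsurj]; exact mem_univ y
      exact ⟨Int.fract r, ⟨Int.fract_nonneg r, (Int.fract_lt_one r).le⟩, apply_fract hp r⟩
    exact (isCompact_Icc.image hc).of_isClosed_subset isClosed_univ h
  have hR : IsCompact (univ : Set ℝ) := by
    rw [← hct, ← c.image_source_eq_target, hsrc]
    exact hcpt.image_of_continuousOn (by rw [← hsrc]; exact c.continuousOn)
  exact not_compactSpace_iff.2 (inferInstance : NoncompactSpace ℝ) (isCompact_univ_iff.1 hR)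

include hc hp hsurj hct in
/-- **The component of `0` in `β⁻¹(c.source)` lies in `(-1, 1)`**: it is order connected, and
if it reached `±1` the whole circle would lie in the source of the arc chart. [folklore] -/
theorem abs_lt_one_of_mem_component {s : ℝ} (hs : s ∈ connectedComponentIn (β ⁻¹' c.source) 0) :
    -1 < s ∧ s < 1 := by
  have hoc : OrdConnected (connectedComponentIn (β ⁻¹' c.source) 0) :=
    isPreconnected_connectedComponentIn.ordConnected
  have h0 : (0 : ℝ) ∈ connectedComponentIn (β ⁻¹' c.source) 0 :=
    mem_connectedComponentIn (connectedComponentIn_nonempty_iff.1 ⟨s, hs⟩)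
  obtain ⟨r, hr⟩ := exists_not_mem_source hc hp hsurj hct
  have hsub : connectedComponentIn (β ⁻¹' c.source) 0 ⊆ β ⁻¹' c.source := connectedComponentIn_subset _ _
  constructor
  · by_contra h
    rw [not_lt] at h
    -- `[-1, 0] ⊆ component`, hence every value of `β` lies in the source
    have hI : Icc (-1 : ℝ) 0 ⊆ β ⁻¹' c.source := fun u hu ↦
      hsub (hoc.out hs h0 ⟨h.trans hu.1, hu.2⟩)
    refine hr ?_
    have h1 : Int.fract r - 1 ∈ Icc (-1 : ℝ) 0 :=
      ⟨by linarith [Int.fract_nonneg r], by linarith [Int.fract_lt_one r]⟩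
    have h2 : β (Int.fract r - 1) = β r := by
      have h := hp (Int.fract r - 1)
      rw [sub_add_cancel, apply_fract hp] at h
      exact h.symm
    rw [← h2]
    exact hI h1
  · by_contra h
    rw [not_lt] at h
    have hI : Icc (0 : ℝ) 1 ⊆ β ⁻¹' c.source := fun u hu ↦
      hsub (hoc.out h0 hs ⟨hu.1, hu.2.trans h⟩)
    refine hr ?_
    rw [← apply_fract hp r]
    exact hI ⟨Int.fract_nonneg r, (Int.fract_lt_one r).le⟩

include hc hp hinj hsurj hct in
/-- **Same side, same sign**: for two points of the component of `0` in `β⁻¹(c.source)` on the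
same side of `0`, the chart coordinates of their images lie on the same side of that of the
base point (else, by the intermediate value theorem, `β` would take the value `β 0` strictly
between `0` and `±1`). [folklore] -/
theorem mul_pos_of_same_side {u u' : ℝ} (hu : u ∈ connectedComponentIn (β ⁻¹' c.source) 0)
    (hu' : u' ∈ connectedComponentIn (β ⁻¹' c.source) 0) (h : (0 < u ∧ 0 < u') ∨ (u < 0 ∧ u' < 0)) :
    0 < (c (β u) - c (β 0)) * (c (β u') - c (β 0)) := by
  have hsub : connectedComponentIn (β ⁻¹' c.source) 0 ⊆ β ⁻¹' c.source := connectedComponentIn_subset _ _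
  have hoc : OrdConnected (connectedComponentIn (β ⁻¹' c.source) 0) :=
    isPreconnected_connectedComponentIn.ordConnected
  have h0S : (0 : ℝ) ∈ β ⁻¹' c.source := connectedComponentIn_nonempty_iff.1 ⟨u, hu⟩
  -- no point strictly between `-1` and `1`, other than `0`, is mapped to `β 0`
  have hne : ∀ v ∈ connectedComponentIn (β ⁻¹' c.source) 0, v ≠ 0 → c (β v) ≠ c (β 0) := by
    intro v hv hv0 heq
    have hβ : β v = β 0 := c.injOn (hsub hv) h0S heq
    obtain ⟨n, hn⟩ := (apply_eq_apply_zero_iff hp hinj v).1 hβ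
    obtain ⟨h₁, h₂⟩ := abs_lt_one_of_mem_component hc hp hsurj hct hv
    rw [← hn] at h₁ h₂ hv0
    have hn0 : n = 0 := by
      have h₁' : (-1 : ℤ) < n := by exact_mod_cast h₁
      have h₂' : n < (1 : ℤ) := by exact_mod_cast h₂
      omega
    exact hv0 (by rw [hn0]; simp)
  -- the intermediate value theorem between `u` and `u'`
  have hcont : ContinuousOn (fun v ↦ c (β v)) (uIcc u u') := by
    refine c.continuousOn.comp hc.continuousOn fun v hv ↦ hsub ?_
    rcases h with ⟨h₁, h₂⟩ | ⟨h₁, h₂⟩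
    · exact hoc.uIcc_subset hu hu' hv
    · exact hoc.uIcc_subset hu hu' hv
  have huu' : ∀ v ∈ uIcc u u', v ≠ 0 := by
    intro v hv hv0
    subst hv0
    rcases h with ⟨h₁, h₂⟩ | ⟨h₁, h₂⟩
    · rcases mem_uIcc.1 hv with ⟨h₃, -⟩ | ⟨h₃, -⟩ <;> linarith
    · rcases mem_uIcc.1 hv with ⟨-, h₃⟩ | ⟨-, h₃⟩ <;> linarith
  have hA : c (β u) - c (β 0) ≠ 0 := sub_ne_zero.2 (hne u hu (by rcases h with ⟨h₁, -⟩ | ⟨h₁, -⟩ <;> linarith))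
  have hB : c (β u') - c (β 0) ≠ 0 := sub_ne_zero.2 (hne u' hu' (by rcases h with ⟨-, h₁⟩ | ⟨-, h₁⟩ <;> linarith))
  rcases lt_trichotomy ((c (β u) - c (β 0)) * (c (β u') - c (β 0))) 0 with hneg | hzero | hpos
  · exfalso
    -- opposite signs: `c (β 0)` is an intermediate value
    have hmem : c (β 0) ∈ uIcc (c (β u)) (c (β u')) := by
      rcases mul_neg_iff.1 hneg with ⟨h₁, h₂⟩ | ⟨h₁, h₂⟩
      · exact mem_uIcc.2 (Or.inr ⟨by linarith, by linarith⟩)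
      · exact mem_uIcc.2 (Or.inl ⟨by linarith, by linarith⟩)
    obtain ⟨v, hv, hvc⟩ := intermediate_value_uIcc hcont hmem
    exact hne v (hoc.uIcc_subset hu hu' hv) (huu' v hv) hvc
  · exact (mul_ne_zero hA hB hzero).elim
  · exact hpos

include hc hp hinj hsurj hct in
/-- **The degree-one criterion.** Let `h` be a loop at `β 0` with lift `Γ` from `0` to the
integer `d`, and `θ₁ ∈ (0, 1/2)` such that (a) `h θ` lies in the source of the arc chart `c`
for `θ ≤ θ₁` and for `θ ≥ 1 - θ₁`, (b) `h θ ≠ β 0` for `θ ∈ [θ₁, 1 - θ₁]`, and (c) the chart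
coordinates of `h θ₁` and `h (1 - θ₁)` lie on opposite sides of that of `β 0`. Then
`d = 1` or `d = -1`. [folklore] -/
theorem lift_eq_one_or_neg_one (h : Path (β 0) (β 0)) (Γ : C(I, ℝ)) (hΓ0 : Γ 0 = 0)
    (hΓ : ∀ θ, β (Γ θ) = h θ) {d : ℤ} (hΓ1 : Γ 1 = d) {θ₁ : I} (hθ₀ : 0 < (θ₁ : ℝ)) (hθhalf : (θ₁ : ℝ) < 1 / 2)
    (ha : ∀ θ : I, (θ : ℝ) ≤ θ₁ ∨ 1 - θ₁ ≤ (θ : ℝ) → h θ ∈ c.source)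
    (hb : ∀ θ : I, (θ₁ : ℝ) ≤ θ → (θ : ℝ) ≤ 1 - θ₁ → h θ ≠ β 0)
    (hside : (c (h θ₁) - c (β 0)) * (c (h (σ θ₁)) - c (β 0)) < 0) : d = 1 ∨ d = -1 := by
  set S : Set ℝ := β ⁻¹' c.source with hS
  set J₀ : Set ℝ := connectedComponentIn S 0 with hJ₀
  -- the lift as a function on the real line
  set G : ℝ → ℝ := fun s ↦ Γ (projIcc 0 1 zero_le_one s) with hG
  have hGc : Continuous G := Γ.continuous.comp continuous_projIcc
  have hGθ : ∀ θ : I, G θ = Γ θ := fun θ ↦ by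
    show Γ (projIcc 0 1 zero_le_one (θ : ℝ)) = Γ θ
    rw [projIcc_val]
  -- (1) on `[0, θ₁]` the lift runs in `J₀`
  have hmemS : ∀ θ : I, (θ : ℝ) ≤ θ₁ ∨ 1 - θ₁ ≤ (θ : ℝ) → Γ θ ∈ S := fun θ hθ ↦ by
    show β (Γ θ) ∈ c.source
    rw [hΓ]
    exact ha θ hθ
  have h₁ : Γ θ₁ ∈ J₀ := by
    have hT : IsPreconnected (G '' Icc 0 θ₁) := isPreconnected_Icc.image G hGc.continuousOn
    have h0T : (0 : ℝ) ∈ G '' Icc 0 θ₁ := ⟨0, ⟨le_rfl, hθ₀.le⟩, by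
      have h := hGθ 0
      rw [hΓ0] at h
      exact h⟩
    have hTS : G '' Icc 0 θ₁ ⊆ S := by
      rintro _ ⟨s, hs, rfl⟩
      have hs01 : s ∈ Icc (0 : ℝ) 1 := ⟨hs.1, hs.2.trans θ₁.2.2⟩
      have := hmemS ⟨s, hs01⟩ (Or.inl hs.2)
      rwa [← hGθ] at this
    have hsub := hT.subset_connectedComponentIn h0T hTS
    have : G θ₁ ∈ G '' Icc 0 θ₁ := ⟨θ₁, ⟨hθ₀.le, le_rfl⟩, rfl⟩
    rw [hGθ] at this
    exact hsub this
  -- (2) on `[1 - θ₁, 1]` the lift, shifted by `-d`, runs in `J₀`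
  have hβd : ∀ v : ℝ, β (v - d) = β v := fun v ↦ by
    have h := hp.sub_int_mul_eq d (x := v)
    rwa [mul_one] at h
  have h₂ : Γ (σ θ₁) - d ∈ J₀ := by
    have hT : IsPreconnected ((fun s ↦ G s - d) '' Icc (1 - θ₁) 1) :=
      isPreconnected_Icc.image _ (hGc.sub continuous_const).continuousOn
    have h0T : (0 : ℝ) ∈ (fun s ↦ G s - d) '' Icc (1 - θ₁) 1 :=
      ⟨1, ⟨by linarith, le_rfl⟩, by
        show G 1 - d = 0
        rw [show (1 : ℝ) = ((1 : I) : ℝ) from rfl, hGθ, hΓ1, sub_self]⟩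
    have hTS : (fun s ↦ G s - d) '' Icc (1 - θ₁) 1 ⊆ S := by
      rintro _ ⟨s, hs, rfl⟩
      have hs01 : s ∈ Icc (0 : ℝ) 1 := ⟨by linarith [hs.1, θ₁.2.2], hs.2⟩
      have h' := hmemS ⟨s, hs01⟩ (Or.inr hs.1)
      show β (G s - d) ∈ c.source
      rw [hβd, hGθ ⟨s, hs01⟩]
      exact h'
    have hsub := hT.subset_connectedComponentIn h0T hTS
    have : G (σ θ₁) - d ∈ (fun s ↦ G s - d) '' Icc (1 - θ₁) 1 :=
      ⟨σ θ₁, ⟨by rw [coe_symm_eq], (σ θ₁).2.2⟩, rfl⟩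
    rw [hGθ] at this
    exact hsub this
  -- (3) the integer parts at `θ₁` and `1 - θ₁` agree (no integer value in between)
  have hle : (θ₁ : ℝ) ≤ 1 - θ₁ := by linarith
  have hnoint : ∀ s ∈ Icc (θ₁ : ℝ) (1 - θ₁), ∀ k : ℤ, G s ≠ k := by
    intro s hs k hk
    have hs01 : s ∈ Icc (0 : ℝ) 1 := ⟨hθ₀.le.trans hs.1, hs.2.trans (by linarith)⟩
    refine hb ⟨s, hs01⟩ hs.1 hs.2 ?_
    rw [← hΓ, ← hGθ, show ((⟨s, hs01⟩ : I) : ℝ) = s from rfl, hk]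
    exact apply_intCast hp k
  have hfloor : ⌊Γ θ₁⌋ = ⌊Γ (σ θ₁)⌋ := by
    have hGcont : ContinuousOn G (Icc (θ₁ : ℝ) (1 - θ₁)) := hGc.continuousOn
    have e₁ : G θ₁ = Γ θ₁ := hGθ θ₁
    have e₂ : G (1 - θ₁) = Γ (σ θ₁) := by rw [← coe_symm_eq, hGθ]
    rcases lt_trichotomy ⌊Γ θ₁⌋ ⌊Γ (σ θ₁)⌋ with hlt | heq | hgt
    · exfalso
      set k := ⌊Γ (σ θ₁)⌋ with hk
      have hk₁ : Γ θ₁ < k := (Int.lt_floor_add_one _).trans_le (by exact_mod_cast hlt)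
      have hk₂ : (k : ℝ) ≤ Γ (σ θ₁) := Int.floor_le _
      obtain ⟨s, hs, hsk⟩ : (k : ℝ) ∈ G '' Icc (θ₁ : ℝ) (1 - θ₁) :=
        intermediate_value_Icc hle hGcont ⟨by rw [e₁]; exact hk₁.le, by rw [e₂]; exact hk₂⟩
      exact hnoint s hs k hsk
    · exact heq
    · exfalso
      set k := ⌊Γ θ₁⌋ with hk
      have hk₁ : Γ (σ θ₁) < k := (Int.lt_floor_add_one _).trans_le (by exact_mod_cast hgt)
      have hk₂ : (k : ℝ) ≤ Γ θ₁ := Int.floor_le _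
      obtain ⟨s, hs, hsk⟩ : (k : ℝ) ∈ G '' Icc (θ₁ : ℝ) (1 - θ₁) :=
        intermediate_value_Icc' hle hGcont ⟨by rw [e₂]; exact hk₁.le, by rw [e₁]; exact hk₂⟩
      exact hnoint s hs k hsk
  -- (4) bounds and the side conditions
  obtain ⟨hl₁, hu₁⟩ := abs_lt_one_of_mem_component hc hp hsurj hct h₁
  obtain ⟨hl₂, hu₂⟩ := abs_lt_one_of_mem_component hc hp hsurj hct h₂
  have hne₁ : Γ θ₁ ≠ 0 := fun h0 ↦ hb θ₁ le_rfl hle (by rw [← hΓ, h0])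
  have hne₂ : Γ (σ θ₁) - d ≠ 0 := fun h0 ↦
    hb (σ θ₁) (by rw [coe_symm_eq]; exact hle) (by rw [coe_symm_eq]) (by rw [← hΓ, ← hβd, h0])
  have hside' : (c (β (Γ θ₁)) - c (β 0)) * (c (β (Γ (σ θ₁) - d)) - c (β 0)) < 0 := by
    rwa [hβd, hΓ, hΓ]
  have hfl₂ : ⌊Γ (σ θ₁)⌋ = d + ⌊Γ (σ θ₁) - d⌋ := by
    rw [show Γ (σ θ₁) = (Γ (σ θ₁) - d) + (d : ℝ) by ring, Int.floor_add_intCast]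
    ring_nf
  rcases lt_or_gt_of_ne hne₁ with hn₁ | hp₁
  · -- `Γ θ₁ ∈ (-1, 0)`: integer part `-1`
    have hf₁ : ⌊Γ θ₁⌋ = -1 := by
      rw [Int.floor_eq_iff]
      exact ⟨by push_cast; linarith, by push_cast; linarith⟩
    rcases lt_or_gt_of_ne hne₂ with hn₂ | hp₂
    · exfalso
      have := mul_pos_of_same_side hc hp hinj hsurj hct h₁ h₂ (Or.inr ⟨hn₁, hn₂⟩)
      linarith
    · right
      have hf₂ : ⌊Γ (σ θ₁) - d⌋ = 0 := by
        rw [Int.floor_eq_iff]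
        exact ⟨by push_cast; linarith, by push_cast; linarith⟩
      rw [hf₁, hfl₂, hf₂] at hfloor
      omega
  · -- `Γ θ₁ ∈ (0, 1)`: integer part `0`
    have hf₁ : ⌊Γ θ₁⌋ = 0 := by
      rw [Int.floor_eq_iff]
      exact ⟨by push_cast; linarith, by push_cast; linarith⟩
    rcases lt_or_gt_of_ne hne₂ with hn₂ | hp₂
    · left
      have hf₂ : ⌊Γ (σ θ₁) - d⌋ = -1 := by
        rw [Int.floor_eq_iff]
        exact ⟨by push_cast; linarith, by push_cast; linarith⟩
      rw [hf₁, hfl₂, hf₂] at hfloor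
      omega
    · exfalso
      have := mul_pos_of_same_side hc hp hinj hsurj hct h₁ h₂ (Or.inl ⟨hp₁, hp₂⟩)
      linarith

include hinj hsurj hct in
/-- **A loop satisfying the degree-one criterion is homotopic, with fixed ends, to the
injective loop or to its reverse.** [folklore] -/
theorem homotopic_loop_or_revLoop [T2Space Y] (h : Path (β 0) (β 0)) {θ₁ : I} (hθ₀ : 0 < (θ₁ : ℝ))
    (hθhalf : (θ₁ : ℝ) < 1 / 2) (ha : ∀ θ : I, (θ : ℝ) ≤ θ₁ ∨ 1 - θ₁ ≤ (θ : ℝ) → h θ ∈ c.source)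
    (hb : ∀ θ : I, (θ₁ : ℝ) ≤ θ → (θ : ℝ) ≤ 1 - θ₁ → h θ ≠ β 0)
    (hside : (c (h θ₁) - c (β 0)) * (c (h (σ θ₁)) - c (β 0)) < 0) :
    h.Homotopic (loop hc hp) ∨ h.Homotopic (revLoop hc hp) := by
  obtain ⟨Γ, hΓ0, hΓ, d, hΓ1⟩ := exists_lift_loop hc hp hinj hsurj h
  rcases lift_eq_one_or_neg_one hc hp hinj hsurj hct h Γ hΓ0 hΓ hΓ1 hθ₀ hθhalf ha hb hside with rfl | rfl
  · exact Or.inl (homotopic_loop_of_lift_eq_one hc hp h Γ hΓ0 hΓ (by rw [hΓ1]; simp))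
  · exact Or.inr (homotopic_revLoop_of_lift_eq_neg_one hc hp h Γ hΓ0 hΓ (by rw [hΓ1]; simp))

end Criterion

end CircleLoops

end Literature.Topology.PlanarFoliations
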